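import Summits.Ventures.CertifiedQuantumChemistry.Certificates.HubbardRingL6U10DQGKernel2
import Summits.Ventures.CertifiedQuantumChemistry.Rows.SOSDualSlices
import Mathlib.Tactic.Eval
import HarnessLib

/-!
# Ventures/CertifiedQuantumChemistry — Certificates/HubbardRingL6U10DQGKernel3S1.lean: KERNEL REPLAY of the DQG lower certificate of
# CERTIFIED row #63 (`hubbardRingTV 6 1 10`, Hubbard ring L = 6, U/t = 10, sector (3,3)) — chain part 3 of 5 (see part 1 `Certificates/HubbardRingL6U10DQGKernel1.lean` for the description)
# — OUTER-ROW-SLICED chain (`Rows/SOSDualSlices.lean`): the biggest Gram block is processed in outer-row slices so that every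
#   kernel declaration stays within the memory budget of the smallest farm node (RULINGS REF-63 / VAR2-45); `…Kernel3.lean` (the unsliced form of step 11, landed) is not imported by this route

HONEST FRAMING (verbatim): certified bounds for a stated model Hamiltonian in a stated basis; not a claim about the real molecule beyond that model.

var-2 (gen 17), zero compute. Continuation of the block-wise kernel replay chain `ringL6U10DQG_C<i>` (each step: an `eval%` literal
re-checked by `decide +kernel`); the chain is split over files so that no single Lean process holds more than a few steps.
-/

set_option linter.style.longLine false

namespace Summit.Ventures.CertifiedQuantumChemistry

namespace Certificates

open SOSDual CARPoly Summit.Ventures.CertifiedQuantumChemistry.Hamiltonians Literature.MathematicalPhysics.QuantumLattice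

set_option maxRecDepth 100000 in
/-- Collected normal form after the block groups `g0 … g9` and outer-row slices 1 … 1 of 4 of `g10` (elaboration-time literal; checked by `ringL6U10DQG_C11s1_ok`). -/
def ringL6U10DQG_C11s1 : EncPoly :=
  eval% encPoly (k := 6) (collect encL 14 (decPoly 6 ringL6U10DQG_C10 ++ CARPoly.normalize encL 14 (negTerms (gramRowsTerms 40 (headDecode 6 ringL6U10DQG_g10) (List.take 18 (headDecode 6 ringL6U10DQG_g10))))))

set_option maxHeartbeats 4000000 in
/-- KERNEL CHECK of step 11: the literal IS the collected normal form. -/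
theorem ringL6U10DQG_C11s1_ok : decPoly 6 ringL6U10DQG_C11s1 =
    collect encL 14 (decPoly 6 ringL6U10DQG_C10 ++ CARPoly.normalize encL 14 (negTerms (gramRowsTerms 40 (headDecode 6 ringL6U10DQG_g10) (List.take 18 (headDecode 6 ringL6U10DQG_g10))))) := by
  decide +kernel

set_option maxRecDepth 100000 in
/-- Collected normal form after the block groups `g0 … g9` and outer-row slices 1 … 2 of 4 of `g10` (elaboration-time literal; checked by `ringL6U10DQG_C11s2_ok`). -/
def ringL6U10DQG_C11s2 : EncPoly :=
  eval% encPoly (k := 6) (collect encL 14 (decPoly 6 ringL6U10DQG_C11s1 ++ CARPoly.normalize encL 14 (negTerms (gramRowsTerms 40 (headDecode 6 ringL6U10DQG_g10) (List.take 18 (List.drop 18 (headDecode 6 ringL6U10DQG_g10)))))))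

set_option maxHeartbeats 4000000 in
/-- KERNEL CHECK of step 12: the literal IS the collected normal form. -/
theorem ringL6U10DQG_C11s2_ok : decPoly 6 ringL6U10DQG_C11s2 =
    collect encL 14 (decPoly 6 ringL6U10DQG_C11s1 ++ CARPoly.normalize encL 14 (negTerms (gramRowsTerms 40 (headDecode 6 ringL6U10DQG_g10) (List.take 18 (List.drop 18 (headDecode 6 ringL6U10DQG_g10)))))) := by
  decide +kernel

end Certificates

end Summit.Ventures.CertifiedQuantumChemistry
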